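import Literature.AnabelianGeometry.SemiGraphs.BTempQDPairQuotients
import HarnessLib

/-!
# Semi-graphs of anabelioids, Appendix: quotients of QD-pairs in `T[A] = B^temp(Π)[Π/H]`
# (Definition A.3 (iii)) — existence criterion and description

Mochizuki, *Semi-graphs of anabelioids*, Publ. RIMS **42** (2006) 221–322, Appendix, Definition A.3
(iii) (manuscript p. 82) [cite: MochizukiSemiAnbd2006, Def A.3(iii) p.82]: quotients `B ≅ A/Γ_A` of
QD-pairs, "if it exists".  Sequel of `BTempQDPairQuotients.lean` (orbit spaces `X/Γ` in `B^temp(Π)`,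
`QDPair.isQuotient_orbitQuotientπ`, the criterion `QDPair.isQuotient_iff_surjective`) for the full
subcategories `B^temp(Π)[Π/H] = BTempRel Π H` of `B^temp(Π)` (objects admitting an arrow to `Π/H`;
the connected quasi-temperoids `T[A]` of Definition A.1 (i), `QuasiTemperoidsCharts.lean`):

* `QDPair.toBTemp` — the underlying QD-pair of `B^temp(Π)` (same object; `Γ` transported along the
  fully faithful inclusion), `QDPair.toBTemp_invariant_iff`;
* `QDPair.isQuotient_of_toBTemp`, `QDPair.IsQuotient.toBTemp`, **`QDPair.isQuotient_iff_toBTemp`** —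
  an arrow of `T[A]` forms a quotient of a QD-pair of `T[A]` iff its underlying arrow forms a quotient
  of the underlying QD-pair in `B^temp(Π)` (so it is a `Γ`-invariant surjection with the `Γ`-orbits
  as fibres); the non-trivial direction uses the test object `X/Γ`, which lies in `T[A]` as soon as
  the target `B` does;
* **`QDPair.exists_isQuotient_iff_toBTemp`** — a QD-pair `(X, Γ)` of `T[A]` HAS a quotient iff the
  orbit space `X/Γ` admits a `Π`-map to `Π/H` (it need not: Remark A.1.2's example `Π = ℤ/2`,
  `X = A = Π`, `Γ = Π` gives `X/Γ = pt`, which has no arrow to the torsor `A`;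
  `QuasiTemperoidsRemarksProofs.lean`).

Elementary `Π`-set theory for the tree's model of (quasi-)temperoids; nothing refers to the IUT
corpus and no side is taken on any disputed claim.
-/

open CategoryTheory CategoryTheory.Limits Topology

namespace Literature.AnabelianGeometry.SemiGraphs

open Literature.AlgebraicGeometry.Frobenioids.QuasiTemperoid (BTempRel cosetAction admitsHomToCoset)
open Literature.AlgebraicGeometry.Frobenioids.QuasiTemperoid.BTempConnected (hom_ρ hom_ext_apply)

universe u

variable {G : Type u} [Group G] [TopologicalSpace G]

namespace QDPair

/-! ### Quotients in `T[A] = B^temp(Π)[Π/H]` -/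

section Rel

variable {H : Subgroup G}

/-- The underlying QD-pair of `B^temp(Π)` of a QD-pair of `B^temp(Π)[Π/H]`: same object, the
subgroup `Γ` transported along the (fully faithful) inclusion. [cite: MochizukiSemiAnbd2006, Def A.3(iii) p.82] -/
def toBTemp (P : QDPair (BTempRel G H)) : QDPair (BTemp G) :=
  ⟨P.A.obj, P.Γ.map (Functor.mapAut P.A (admitsHomToCoset G H).ι)⟩

/-- The transported automorphism is the underlying one. [cite: MochizukiSemiAnbd2006, Def A.3(iii) p.82] -/
@[simp] theorem mapAut_ι_hom {P : QDPair (BTempRel G H)} (γ : Aut P.A) :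
    ((Functor.mapAut P.A (admitsHomToCoset G H).ι) γ).hom = γ.hom.hom := rfl

/-- Membership in the transported subgroup. [cite: MochizukiSemiAnbd2006, Def A.3(iii) p.82] -/
theorem mem_toBTemp_Γ_iff {P : QDPair (BTempRel G H)} {δ : Aut P.toBTemp.A} :
    δ ∈ P.toBTemp.Γ ↔ ∃ γ ∈ P.Γ, (Functor.mapAut P.A (admitsHomToCoset G H).ι) γ = δ :=
  Subgroup.mem_map

/-- `Γ`-invariance (Def. A.3 (iii) (a)) is the same upstairs and downstairs. [cite: MochizukiSemiAnbd2006, Def A.3(iii) p.82] -/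
theorem toBTemp_invariant_iff {P : QDPair (BTempRel G H)} {C : BTempRel G H} (ψ : P.A ⟶ C) :
    (∀ δ ∈ P.toBTemp.Γ, δ.hom ≫ ψ.hom = ψ.hom) ↔ ∀ γ ∈ P.Γ, γ.hom ≫ ψ = ψ := by
  constructor
  · intro h γ hγ
    apply (admitsHomToCoset G H).hom_ext
    exact h _ (Subgroup.mem_map_of_mem _ hγ)
  · intro h δ hδ
    obtain ⟨γ, hγ, rfl⟩ := mem_toBTemp_Γ_iff.mp hδ
    exact congrArg InducedCategory.Hom.hom (h γ hγ)

/-- **From `B^temp(Π)` to `T[A]`**: if the underlying arrow forms a quotient of the underlying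
QD-pair in `B^temp(Π)`, then the arrow forms a quotient in the full subcategory `B^temp(Π)[Π/H]`
(test objects of the subcategory are test objects of `B^temp(Π)`; full faithfulness gives the
factorisation and its uniqueness). [cite: MochizukiSemiAnbd2006, Def A.3(iii) p.82] -/
theorem isQuotient_of_toBTemp (P : QDPair (BTempRel G H)) {B : BTempRel G H} (φ : P.A ⟶ B)
    (h : P.toBTemp.IsQuotient φ.hom) : P.IsQuotient φ := by
  refine ⟨(toBTemp_invariant_iff φ).mp h.1, fun C ψ hψ => ?_⟩
  obtain ⟨ψ', hψ', huniq⟩ := h.2 ψ.hom ((toBTemp_invariant_iff ψ).mpr hψ)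
  refine ⟨ObjectProperty.homMk ψ', (admitsHomToCoset G H).hom_ext hψ', fun χ hχ => ?_⟩
  apply (admitsHomToCoset G H).hom_ext
  exact huniq χ.hom (congrArg InducedCategory.Hom.hom hχ)

variable [IsTopologicalGroup G]

/-- **From `T[A]` to `B^temp(Π)`**: if `φ : X → B` forms a quotient of `(X, Γ)` in `B^temp(Π)[Π/H]`,
then the underlying arrow forms a quotient in `B^temp(Π)` — i.e. `φ` is surjective with the
`Γ`-orbits as fibres.  The test object used is the orbit space `X/Γ`, which lies in `T[A]` because
it maps to `B`. [cite: MochizukiSemiAnbd2006, Def A.3(iii) p.82] -/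
theorem IsQuotient.toBTemp {P : QDPair (BTempRel G H)} {B : BTempRel G H} {φ : P.A ⟶ B}
    (h : P.IsQuotient φ) : P.toBTemp.IsQuotient φ.hom := by
  have hinv : ∀ δ ∈ P.toBTemp.Γ, δ.hom ≫ φ.hom = φ.hom := (toBTemp_invariant_iff φ).mpr h.1
  -- the orbit space, as an object of `T[A]` via `X/Γ → B → Π/H`
  let d : P.toBTemp.orbitQuotient ⟶ B.obj := P.toBTemp.orbitQuotientDesc φ.hom hinv
  obtain ⟨β⟩ := B.property
  let Q : BTempRel G H := ⟨P.toBTemp.orbitQuotient, ⟨d.hom ≫ β⟩⟩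
  let π : P.A ⟶ Q := ObjectProperty.homMk P.toBTemp.orbitQuotientπ
  have hπ : ∀ γ ∈ P.Γ, γ.hom ≫ π = π := (toBTemp_invariant_iff π).mp
    fun δ hδ => P.toBTemp.aut_comp_orbitQuotientπ hδ
  obtain ⟨χ, hχ, -⟩ := h.2 π hπ
  have hχ' : φ.hom ≫ χ.hom = P.toBTemp.orbitQuotientπ := congrArg InducedCategory.Hom.hom hχ
  -- `χ ≫ d = 𝟙 B` by the uniqueness clause applied to `φ` itself
  obtain ⟨ι₀, -, hι₀⟩ := h.2 φ h.1
  have h1 : (𝟙 B : B ⟶ B) = ι₀ := hι₀ _ (Category.comp_id φ)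
  have h2 : χ ≫ ObjectProperty.homMk d = ι₀ := hι₀ _ (by
    apply (admitsHomToCoset G H).hom_ext
    show φ.hom ≫ χ.hom ≫ d = φ.hom
    rw [← Category.assoc, hχ']
    exact P.toBTemp.orbitQuotientπ_desc φ.hom hinv)
  have hχd : χ.hom ≫ d = 𝟙 B.obj := congrArg InducedCategory.Hom.hom (h2.trans h1.symm)
  refine (P.toBTemp.isQuotient_iff_surjective φ.hom).mpr ⟨hinv, ?_, ?_⟩
  · intro b
    obtain ⟨x, hx⟩ := P.toBTemp.orbitMk_surjective (χ.hom.hom.hom b)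
    refine ⟨x, ?_⟩
    show (d.hom.hom (P.toBTemp.orbitMk x) : B.obj.obj.V) = b
    rw [hx]
    show ((χ.hom ≫ d).hom.hom b : B.obj.obj.V) = b
    rw [hχd]
    rfl
  · intro x y hxy
    apply P.toBTemp.orbitMk_eq_iff.mp
    have ex : ∀ z : P.toBTemp.A.obj.V,
        P.toBTemp.orbitMk z = χ.hom.hom.hom (φ.hom.hom.hom z) := fun z => by
      show (P.toBTemp.orbitQuotientπ.hom.hom z : P.toBTemp.orbitQuotient.obj.V) = _
      rw [← hχ']
      rfl
    rw [ex, ex]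
    exact congrArg (fun b : B.obj.obj.V => (χ.hom.hom.hom b : P.toBTemp.orbitQuotient.obj.V)) hxy

/-- **Definition A.3 (iii) in `T[A]`, characterised**: an arrow of `B^temp(Π)[Π/H]` forms a quotient
of a QD-pair iff its underlying arrow of `B^temp(Π)` does (iff it is a `Γ`-invariant surjection with
the `Γ`-orbits as fibres, `isQuotient_iff_surjective`). [cite: MochizukiSemiAnbd2006, Def A.3(iii) p.82] -/
theorem isQuotient_iff_toBTemp (P : QDPair (BTempRel G H)) {B : BTempRel G H} (φ : P.A ⟶ B) :
    P.IsQuotient φ ↔ P.toBTemp.IsQuotient φ.hom :=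
  ⟨IsQuotient.toBTemp, P.isQuotient_of_toBTemp φ⟩

/-- **When does a QD-pair of `T[A]` have a quotient?**  Exactly when the orbit space `X/Γ` admits a
`Π`-map to `Π/H`, i.e. lies in `T[A]`; then `X → X/Γ` is the quotient.  (It can fail: for `Π = ℤ/2`
acting on `X = A = Π` and `Γ = Π`, `X/Γ` is a point, which admits no map to the torsor `A` —
Remark A.1.2.) [cite: MochizukiSemiAnbd2006, Def A.3(iii) p.82] -/
theorem exists_isQuotient_iff_toBTemp (P : QDPair (BTempRel G H)) :
    (∃ (B : BTempRel G H) (φ : P.A ⟶ B), P.IsQuotient φ) ↔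
      admitsHomToCoset G H P.toBTemp.orbitQuotient := by
  constructor
  · rintro ⟨B, φ, h⟩
    obtain ⟨β⟩ := B.property
    have hinv : ∀ δ ∈ P.toBTemp.Γ, δ.hom ≫ φ.hom = φ.hom := (toBTemp_invariant_iff φ).mpr h.1
    exact ⟨(P.toBTemp.orbitQuotientDesc φ.hom hinv).hom ≫ β⟩
  · intro hQ
    refine ⟨⟨P.toBTemp.orbitQuotient, hQ⟩, ObjectProperty.homMk P.toBTemp.orbitQuotientπ, ?_⟩
    exact P.isQuotient_of_toBTemp _ P.toBTemp.isQuotient_orbitQuotientπ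

end Rel

end QDPair

end Literature.AnabelianGeometry.SemiGraphs
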